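import Summits.ResolutionOfSingularities.ResolutionOfSingularities.Theorems.FrobeniusClosingSteerSwitchingSetup
import Mathlib.Algebra.CharP.Lemmas
import Mathlib.Algebra.CharP.Algebra

/-!
# Steer core, stub S0 `CompositeRankSS`, ν₁ input — part 1/2: lemmas (value-group arithmetic, Frobenius into `Frac A₀`, HOT Lemma 3.2)

OURS (campaign res-hironaka, rung L, slot W4.1, crux `Steer` stmt-ResolutionOfSingularities-16345, line
`switching_dichotomy` / res-L0-w41-strat-1's `ss-monomial-cycles` §F, registered frontier stub S0 `CompositeRankSS`; prover
seat res-type-028 gen 8 (the ν₁ input ⟨H1D-DISCRETE⟩ of the (b)-bridge `concl_of_discreteCoarsening_of_luZeroDimBelow`,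
`Theorems/FrobeniusClosingSteerCompositeRankLUBelow.lean`); replaces the role of no printed item; NOT a statement of the
manuscript under review; AI-produced, weaker than expert review). `--supports stmt-ResolutionOfSingularities-16345 --as helper`.
Theses-free, definition-free. Part 2/2 (`…ShannonCoarseningDiscrete.lean`) proves `discrete_of_stronglySwitching`: EVERY proper
coarsening of a strongly switching valuation ring (for the torsor datum of `Steer`) is discrete of rank one, after
Heinzer–Loper–Olberding–Schoutens–Toeniskoetter, *Ideal theory of infinite directed unions of local quadratic transforms* (arXiv:1505.06445),
Lemma 3.2 and Proposition 3.3. This part supplies the three ingredients: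

* §1 `exists_discrete_of_pow` — if `v π < 1` and the value of the `p`-th power of every non-zero element is an integer power
  of `v π`, the valuation is discrete of rank one (Euclidean division of exponents; `p`-th roots are unique in the value group);
* §2 `pow_mem_of_mem_adjoin_insert`, `exists_pow_eq_div` — `K ^ p ⊆ Frac A₀` for `Frac A₀[t] = K`, `t ^ p ∈ A₀` (Frobenius);
* §3 `valuation_eq_one_of_le`, `locAtCentre_locAtCentre_of_le`, `locAtCentre_blowupRing_eq_of_valuation_eq_one`,
  `locAtCentre_eq_of_isQuadraticTransformAlong` — HOT Lemma 3.2 («blowing up `𝔪` is an isomorphism off the closed fibre»):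
  once some non-unit of a member is a unit of the coarsening `O₁`, the quadratic transform along `O` does not change the
  local ring at the centre of `O₁`.
-/

noncomputable section

-- single-problem summit: the doubled namespace component `ResolutionOfSingularities` is forced
set_option linter.dupNamespace false

open scoped BigOperators Classical

namespace Summit.ResolutionOfSingularities.ResolutionOfSingularities.Theorems.SwitchingDichotomy.Shannon

open IsLocalRing
open Literature.AlgebraicGeometry.Resolution

variable {k K : Type} [Field k] [Field K] [Algebra k K]

/-! ## §1 Value-group arithmetic: cyclic value image from `p`-th powers -/

/-- **Discreteness from `p`-th powers.** If `π ≠ 0` has value `< 1` and the value of the `p`-th power of every non-zero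
element is an integer power of the value of `π`, then the valuation is discrete of rank one: some `ϖ` (a non-zero element
whose `p`-th power has the least positive `π`-exponent) has `v ϖ < 1` and every non-zero value is an integer power of
`v ϖ` (Euclidean division of exponents; `p`-th roots are unique in the linearly ordered value group). [folklore] -/
theorem exists_discrete_of_pow (O : ValuationSubring K) {p : ℕ} (hp : 0 < p)
    {π : K} (hπ0 : π ≠ 0) (hπ : O.valuation π < 1)
    (H : ∀ z : K, z ≠ 0 → ∃ e : ℤ, O.valuation (z ^ p) = O.valuation π ^ e) :
    ∃ ϖ : K, ϖ ≠ 0 ∧ O.valuation ϖ < 1 ∧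
      ∀ z : K, z ≠ 0 → ∃ m : ℤ, O.valuation z = O.valuation ϖ ^ m := by
  classical
  set v := O.valuation with hv
  have hvπ0 : v π ≠ 0 := (map_ne_zero v).mpr hπ0
  -- the least positive natural exponent that occurs
  let P : ℕ → Prop := fun d => 0 < d ∧ ∃ z : K, z ≠ 0 ∧ v (z ^ p) = v π ^ (d : ℤ)
  have hP : ∃ d, P d := ⟨p, hp, π, hπ0, by rw [map_pow, zpow_natCast]⟩
  let d := Nat.find hP
  have hd : P d := Nat.find_spec hP
  have hdmin : ∀ r, P r → d ≤ r := fun r hr => Nat.find_min' hP hr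
  obtain ⟨hd0, ϖ, hϖ0, hϖ⟩ := hd
  have hvϖ0 : v ϖ ≠ 0 := (map_ne_zero v).mpr hϖ0
  -- every exponent is a multiple of `d`
  have hdvd : ∀ z : K, z ≠ 0 → ∀ e : ℤ, v (z ^ p) = v π ^ e → (d : ℤ) ∣ e := by
    intro z hz e he
    have hd0' : (d : ℤ) ≠ 0 := by exact_mod_cast hd0.ne'
    set q := e / d with hq
    set r := e % d with hr
    have her : e = d * q + r := by rw [hq, hr]; exact (Int.mul_ediv_add_emod e d).symm
    have hr0 : 0 ≤ r := Int.emod_nonneg e hd0'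
    have hrd : r < d := Int.emod_lt_of_pos e (by exact_mod_cast hd0)
    -- the element `z / ϖ ^ q` has exponent `r`
    have hz' : z / ϖ ^ q ≠ 0 := div_ne_zero hz (zpow_ne_zero q hϖ0)
    have hval : v ((z / ϖ ^ q) ^ p) = v π ^ r := by
      rw [div_pow, map_div₀, he, ← zpow_natCast (ϖ ^ q) p, ← zpow_mul, mul_comm, zpow_mul,
        zpow_natCast, map_zpow₀, hϖ, ← zpow_mul, her]
      rw [zpow_add₀ hvπ0, mul_div_cancel_left₀ _ (zpow_ne_zero _ hvπ0)]
    by_contra hnd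
    have hrne : r ≠ 0 := by
      intro hr0'
      apply hnd
      rw [her, hr0', add_zero]
      exact dvd_mul_right _ _
    have hrpos : 0 < r := lt_of_le_of_ne hr0 (Ne.symm hrne)
    have hPr : P r.toNat := by
      refine ⟨by omega, z / ϖ ^ q, hz', ?_⟩
      rw [hval, Int.toNat_of_nonneg hr0]
    have := hdmin _ hPr
    omega
  refine ⟨ϖ, hϖ0, ?_, ?_⟩
  · -- `v ϖ < 1` since `v (ϖ ^ p) = v π ^ d < 1`
    by_contra hge
    push Not at hge
    have h1 : 1 ≤ v (ϖ ^ p) := by rw [map_pow]; exact one_le_pow₀ hge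
    have h2 : v π ^ (d : ℤ) < 1 := by
      rw [zpow_natCast]; exact pow_lt_one₀ zero_le hπ hd0.ne'
    rw [hϖ] at h1
    exact absurd (lt_of_lt_of_le h2 h1) (lt_irrefl _)
  · intro z hz
    obtain ⟨e, he⟩ := H z hz
    obtain ⟨m, hm⟩ := hdvd z hz e he
    refine ⟨m, ?_⟩
    have hp0 : p ≠ 0 := hp.ne'
    have key : v z ^ p = (v ϖ ^ m) ^ p := by
      rw [← map_pow, he, hm, zpow_mul, ← hϖ, map_pow, ← zpow_natCast, ← zpow_natCast (v ϖ ^ m) p,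
        ← zpow_mul, ← zpow_mul, mul_comm]
    exact (pow_left_inj₀ zero_le zero_le hp0).mp key

/-! ## §2 Frobenius: `K ^ p ⊆ Frac A₀` -/

/-- For `t ^ p ∈ A₀`, the `p`-th power of every element of `A₀[t]` lies in `A₀` (Frobenius is additive in characteristic
`p`). [folklore] -/
theorem pow_mem_of_mem_adjoin_insert (p : ℕ) [Fact p.Prime] [CharP K p] (A₀ : Subalgebra k K) {t : K}
    (htp : t ^ p ∈ A₀) {x : K} (hx : x ∈ Algebra.adjoin k (insert t (A₀ : Set K))) : x ^ p ∈ A₀ := by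
  induction hx using Algebra.adjoin_induction with
  | mem x hx =>
    rcases Set.mem_insert_iff.mp hx with rfl | hx
    · exact htp
    · exact A₀.pow_mem hx p
  | algebraMap r =>
    rw [← map_pow]
    exact A₀.algebraMap_mem (r ^ p)
  | add x y _ _ hx hy =>
    rw [add_pow_char_of_commute p (Commute.all x y)]
    exact A₀.add_mem hx hy
  | mul x y _ _ hx hy =>
    rw [mul_pow]
    exact A₀.mul_mem hx hy

/-- **`K ^ p ⊆ Frac A₀`**: with `Frac A₀[t] = K` and `t ^ p ∈ A₀`, the `p`-th power of every `z ∈ K` is a fraction `y / w` of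
elements of `A₀` (`w ≠ 0`). [folklore] -/
theorem exists_pow_eq_div (p : ℕ) [Fact p.Prime] [CharP K p] (A₀ : Subalgebra k K) (t : K) (htp : t ^ p ∈ A₀)
    (hfr : IsFractionRing (Algebra.adjoin k (insert t (A₀ : Set K))) K) (z : K) :
    ∃ y ∈ A₀, ∃ w ∈ A₀, w ≠ 0 ∧ z ^ p = y / w := by
  haveI := hfr
  obtain ⟨a, b, hb, rfl⟩ := IsFractionRing.div_surjective (A := Algebra.adjoin k (insert t (A₀ : Set K))) z
  have hb0 : (b : K) ≠ 0 := by
    have : (b : Algebra.adjoin k (insert t (A₀ : Set K))) ≠ 0 := nonZeroDivisors.ne_zero hb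
    exact fun h => this (Subtype.ext h)
  refine ⟨(a : K) ^ p, pow_mem_of_mem_adjoin_insert p A₀ htp a.2, (b : K) ^ p,
    pow_mem_of_mem_adjoin_insert p A₀ htp b.2, pow_ne_zero _ hb0, ?_⟩
  change ((a : K) / (b : K)) ^ p = _
  rw [div_pow]

/-! ## §3 HOT Lemma 3.2: the local ring at a non-maximal centre survives the quadratic transform -/

/-- Units of `O` are units of every coarsening `O₁ ⊇ O`. [folklore] -/
theorem valuation_eq_one_of_le {O O₁ : ValuationSubring K} (hO : O ≤ O₁) {x : K}
    (hx : O.valuation x = 1) : O₁.valuation x = 1 := by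
  have hxO : x ∈ O := (O.valuation_le_one_iff x).mp hx.le
  have hx0 : x ≠ 0 := by rintro rfl; simp at hx
  have hxiO : x⁻¹ ∈ O := by rw [← O.valuation_le_one_iff, map_inv₀, hx, inv_one]
  apply le_antisymm ((O₁.valuation_le_one_iff x).mpr (hO hxO))
  have h := (O₁.valuation_le_one_iff x⁻¹).mpr (hO hxiO)
  rwa [map_inv₀, inv_le_one₀ ((Valuation.pos_iff _).mpr hx0)] at h

/-- `(B_{𝔪_O ∩ B})_{𝔪_{O₁} ∩ ·} = B_{𝔪_{O₁} ∩ B}` for `O ≤ O₁`: localising at the centre of `O` and then at the centre of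
the coarsening `O₁` is localising at the centre of `O₁`. [cite: NovacoskiSpivakovsky2014, Lemma 2.5] [folklore] -/
theorem locAtCentre_locAtCentre_of_le {B : Subring K} {O O₁ : ValuationSubring K} (hO : O ≤ O₁) :
    locAtCentre (locAtCentre B O) O₁ = locAtCentre B O₁ := by
  refine le_antisymm ?_ (locAtCentre_mono O₁ (le_locAtCentre B O))
  rintro _ ⟨y, hy, z, hz, hvz, rfl⟩
  obtain ⟨a, ha, b, hb, hvb, rfl⟩ := hy
  obtain ⟨c, hc, d, hd, hvd, rfl⟩ := hz
  have hb1 : O₁.valuation b = 1 := valuation_eq_one_of_le hO hvb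
  have hd1 : O₁.valuation d = 1 := valuation_eq_one_of_le hO hvd
  have hb0 : b ≠ 0 := ne_zero_of_valuation_eq_one hvb
  have hd0 : d ≠ 0 := ne_zero_of_valuation_eq_one hvd
  have hc1 : O₁.valuation c = 1 := by
    rw [map_div₀, hd1, div_one] at hvz
    exact hvz
  have hc0 : c ≠ 0 := ne_zero_of_valuation_eq_one hc1
  refine ⟨a * d, B.mul_mem ha hd, b * c, B.mul_mem hb hc, by rw [map_mul, hb1, hc1, mul_one], ?_⟩
  field_simp

/-- For a local subring `R ⊆ O₁` and `x ∈ R` a UNIT of `O₁`, the chart ring `R[𝔪_R/x]` and `R` have the same local ring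
at the centre of `O₁` (every `y / x` already lies in `R_{𝔪_{O₁} ∩ R}`). [cite: HeinzerEtAl2015, Lemma 3.2] -/
theorem locAtCentre_blowupRing_eq_of_valuation_eq_one {R : Subring K} [IsLocalRing R] {O₁ : ValuationSubring K}
    {x : K} (hxR : x ∈ R) (hx : O₁.valuation x = 1) :
    locAtCentre (blowupRing R x) O₁ = locAtCentre R O₁ := by
  refine le_antisymm ?_ (locAtCentre_mono O₁ (le_blowupRing R x))
  have hle : blowupRing R x ≤ locAtCentre R O₁ := by
    refine Subring.closure_le.mpr ?_
    rintro z (hz | ⟨y, -, rfl⟩)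
    · exact le_locAtCentre R O₁ hz
    · exact ⟨y, y.2, x, hxR, hx, rfl⟩
  calc locAtCentre (blowupRing R x) O₁ ≤ locAtCentre (locAtCentre R O₁) O₁ := locAtCentre_mono O₁ hle
    _ = locAtCentre R O₁ := locAtCentre_locAtCentre R O₁

/-- **HOT Lemma 3.2 («blowing up `𝔪` is an isomorphism off the closed fibre»).** If `R₁` is the quadratic transform of
`R` along `O`, `O ≤ O₁`, and some non-unit `u ∈ R` of `O` is a unit of `O₁` (the centre of `O₁` on `R` is not the maximal
ideal), then `R` and `R₁` have the same local ring at the centre of `O₁`: the generator `x` of `𝔪_R` of minimal `O`-value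
divides `u` in `O`, so it is a unit of `O₁` too. [cite: HeinzerEtAl2015, Lemma 3.2] -/
theorem locAtCentre_eq_of_isQuadraticTransformAlong {O O₁ : ValuationSubring K} (hO : O ≤ O₁) {R R₁ : Subring K}
    (h : IsQuadraticTransformAlong O R R₁) {u : K} (huR : u ∈ R) (huO : O.valuation u < 1)
    (hu₁ : O₁.valuation u = 1) : locAtCentre R₁ O₁ = locAtCentre R O₁ := by
  have hRO : R ≤ O.toSubring := h.source_le
  obtain ⟨_, x, hx, hx0, hmin, rfl⟩ := h.exists_eq_locAtCentre
  have hx0' : ((x : R) : K) ≠ 0 := fun e => hx0 (Subtype.ext e)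
  -- `u ∈ 𝔪_R`, so `v_O u ≤ v_O x`, whence `x` is a unit of `O₁`
  have hum : (⟨u, huR⟩ : R) ∈ maximalIdeal R := by
    rw [mem_maximalIdeal, mem_nonunits_iff]
    rintro ⟨w, hw⟩
    have h1 : ((w : R) : K) * ((↑w⁻¹ : R) : K) = 1 := by
      rw [← Subring.coe_mul, Units.mul_inv, Subring.coe_one]
    have hwu : ((w : R) : K) = u := congrArg Subtype.val hw
    rw [hwu] at h1
    have h2 : O.valuation u * O.valuation ((↑w⁻¹ : R) : K) = 1 := by rw [← map_mul, h1, map_one]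
    have h3 : O.valuation ((↑w⁻¹ : R) : K) ≤ 1 := (O.valuation_le_one_iff _).mpr (hRO (↑w⁻¹ : R).2)
    have : O.valuation u * O.valuation ((↑w⁻¹ : R) : K) < 1 * 1 :=
      mul_lt_mul_of_lt_of_le_of_nonneg_of_pos huO h3 zero_le zero_lt_one
    rw [h2, one_mul] at this
    exact lt_irrefl _ this
  have hux : O.valuation u ≤ O.valuation (x : K) := hmin _ hum
  have hx1 : O₁.valuation (x : K) = 1 := by
    apply le_antisymm ((O₁.valuation_le_one_iff _).mpr (hO (hRO x.2)))
    -- `u / x ∈ O ⊆ O₁` and `v₁ u = 1`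
    have hdiv : u / (x : K) ∈ O := by
      rw [← O.valuation_le_one_iff, map_div₀]
      exact div_le_one_of_le₀ hux zero_le
    have h1 : O₁.valuation (u / (x : K)) ≤ 1 := (O₁.valuation_le_one_iff _).mpr (hO hdiv)
    rw [map_div₀, hu₁] at h1
    have hxpos : 0 < O₁.valuation (x : K) := (Valuation.pos_iff _).mpr hx0'
    exact (div_le_one₀ hxpos).mp h1
  rw [locAtCentre_locAtCentre_of_le hO]
  exact locAtCentre_blowupRing_eq_of_valuation_eq_one x.2 hx1

end Summit.ResolutionOfSingularities.ResolutionOfSingularities.Theorems.SwitchingDichotomy.Shannon
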